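import Mathlib.Analysis.Calculus.LogDerivUniformlyOn
import Mathlib.Analysis.Normed.Module.MultipliableUniformlyOn
import Literature.Analysis.Complex.HadamardGenusOne
import Literature.Analysis.Complex.GaussLucasGenusZero
import HarnessLib

/-!
# The logarithmic derivative of a genus-one Hadamard product, and the exact two-point identity

C3 «analysis» rh-idea-3 g41 (W-08, crux 33346 `TiltedLandingLaw421R`), files-only scratch, 2026-08-30.
Service for C1 g28's NewtonDoor (v9/v10 `farField_bound_of_ne_zero`, `lipschitz_of_near_far`): the
far-field Lipschitz constant WITHOUT a Landau/Borel–Carathéodory `ε/δ` term. For an entire `F` of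
order `< 2` the tree's PROVED `Literature.Analysis.Complex.hadamard_genus_one_zeros` gives Hadamard data
`F z / (F 0 · e^{A z}) = ∏ₙ (1 − bₙ z) e^{bₙ z}`, `Σ ‖bₙ‖² < ∞` (`bₙ` = inverse zeros with multiplicity).
Here (genus-one twin of `GaussLucasGenusZero.logDeriv_eq_tsum_of_hasProd_one_sub_mul`):
* `logDeriv_eq_const_add_tsum` — `F'/F (x) = A + Σₙ (−bₙ² x)/(1 − bₙ x)` (`= A + Σ' [1/(x − aₙ) + 1/aₙ]`)
  off the zeros (Mathlib `logDeriv_tprod_eq_tsum`, the product converging locally uniformly on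
  `‖z‖ < ‖x‖ + 1` by `‖(1 − w)e^{w} − 1‖ ≤ ‖w‖² e^{‖w‖}` = tree `HadamardGenusOne.norm_primaryFactor_sub_one_le`);
* `logDeriv_sub_logDeriv_eq_tsum` — the EXACT TWO-POINT IDENTITY
  `F'/F (z) − F'/F (v) = Σₙ bₙ² (v − z)/((1 − bₙ z)(1 − bₙ v))` (`= Σ' (v − z)/((aₙ − z)(aₙ − v))`):
  the linear exponent `A` CANCELS;
* `norm_logDeriv_sub_logDeriv_le` — `‖F'/F (z) − F'/F (v)‖ ≤ ‖z − v‖ · Σₙ ‖bₙ‖²/(‖1 − bₙ z‖ ‖1 − bₙ v‖)`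
  (`= ‖z − v‖ · Σ' 1/(‖aₙ − z‖ ‖aₙ − v‖)`), the Lipschitz bound of the pricing note
  `g41/w08/NewtonDoor-farfield-pricing-C3-g41.md` §3.
Mathlib + tree only; standard axioms expected. Nothing here bears on the truth of RH; RH is not proved.
[cite: Conway1978, Ch. XI Thm. 3.4 (Hadamard factorisation); Boas1954, §2.7–2.8]
-/

noncomputable section

open Complex Filter Topology Set

namespace Literature.Analysis.Complex

namespace GenusOneLogDerivC3g41

/-- If `F z / (F 0 · e^{A z}) = ∏ (1 − bₙ z) e^{bₙ z}`, `F 0 ≠ 0` and `F x ≠ 0`, no primary factor vanishes at `x`. -/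
theorem primaryFactor_ne_zero_of_hasProd {F : ℂ → ℂ} {A : ℂ} {b : ℕ → ℂ}
    (hprod : ∀ z : ℂ, HasProd (fun n ↦ (1 - b n * z) * exp (b n * z)) (F z / (F 0 * exp (A * z))))
    (h0 : F 0 ≠ 0) {x : ℂ} (hx : F x ≠ 0) (n : ℕ) : (1 - b n * x) * exp (b n * x) ≠ 0 := by
  intro h
  have := Literature.NumberTheory.LFunctions.hasProd_zero_of_eq_zero (hprod x) h
  rcases div_eq_zero_iff.1 this with h' | h'
  · exact hx h'
  · rcases mul_eq_zero.1 h' with h'' | h''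
    · exact h0 h''
    · exact Complex.exp_ne_zero _ h''

/-- The linear factor `1 − bₙ x` is non-zero at a non-zero of `F`. -/
theorem one_sub_mul_ne_zero_of_hasProd {F : ℂ → ℂ} {A : ℂ} {b : ℕ → ℂ}
    (hprod : ∀ z : ℂ, HasProd (fun n ↦ (1 - b n * z) * exp (b n * z)) (F z / (F 0 * exp (A * z))))
    (h0 : F 0 ≠ 0) {x : ℂ} (hx : F x ≠ 0) (n : ℕ) : 1 - b n * x ≠ 0 :=
  (mul_ne_zero_iff.1 (primaryFactor_ne_zero_of_hasProd hprod h0 hx n)).1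

/-- `Σ ‖bₙ‖² < ∞ ⇒ bₙ → 0`. -/
theorem tendsto_zero_of_summable_norm_sq {b : ℕ → ℂ} (hb : Summable fun n ↦ ‖b n‖ ^ 2) :
    Tendsto b atTop (𝓝 0) := by
  have h1 : Tendsto (fun n ↦ ‖b n‖ ^ 2) atTop (𝓝 0) := hb.tendsto_atTop_zero
  have h2 : Tendsto (fun n ↦ Real.sqrt (‖b n‖ ^ 2)) atTop (𝓝 (Real.sqrt 0)) := h1.sqrt
  have h3 : Tendsto (fun n ↦ ‖b n‖) atTop (𝓝 0) := by
    have e : (fun n ↦ Real.sqrt (‖b n‖ ^ 2)) = fun n ↦ ‖b n‖ :=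
      funext fun n ↦ Real.sqrt_sq (norm_nonneg _)
    rw [e, Real.sqrt_zero] at h2
    exact h2
  exact tendsto_zero_iff_norm_tendsto_zero.2 h3

/-- Eventually `‖bₙ‖ · ρ ≤ c` for any `c > 0`. -/
theorem eventually_norm_mul_le {b : ℕ → ℂ} (hb : Summable fun n ↦ ‖b n‖ ^ 2) (ρ : ℝ) {c : ℝ}
    (hc : 0 < c) : ∀ᶠ n in atTop, ‖b n‖ * ρ ≤ c := by
  have h0 := tendsto_zero_of_summable_norm_sq hb
  have : Tendsto (fun n ↦ b n * (ρ : ℂ)) atTop (𝓝 0) := by simpa using h0.mul_const (ρ : ℂ)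
  have := (tendsto_zero_iff_norm_tendsto_zero.1 this).eventually (ge_mem_nhds hc)
  filter_upwards [this] with n hn
  calc ‖b n‖ * ρ ≤ ‖b n‖ * |ρ| := by
        exact mul_le_mul_of_nonneg_left (le_abs_self ρ) (norm_nonneg _)
    _ = ‖b n * (ρ : ℂ)‖ := by rw [norm_mul, Complex.norm_real, Real.norm_eq_abs]
    _ ≤ c := hn

/-- The genus-one log-derivative terms are absolutely summable off the zeros:
`‖bₙ² x/(1 − bₙ x)‖ ≤ 2 ‖x‖ ‖bₙ‖²` eventually. -/
theorem summable_norm_logDeriv_terms₂ {b : ℕ → ℂ} (hb : Summable fun n ↦ ‖b n‖ ^ 2) (x : ℂ) :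
    Summable fun n ↦ ‖-(b n) ^ 2 * x / (1 - b n * x)‖ := by
  have hev : ∀ᶠ n in atTop, ‖b n‖ * ‖x‖ ≤ 1 / 2 := eventually_norm_mul_le hb ‖x‖ (by norm_num)
  refine Summable.of_norm_bounded_eventually (g := fun n ↦ 2 * ‖x‖ * ‖b n‖ ^ 2)
    ((hb.mul_left (2 * ‖x‖))) ?_
  rw [Nat.cofinite_eq_atTop]
  filter_upwards [hev] with n hn
  rw [norm_norm, norm_div, norm_mul, norm_neg, norm_pow]
  have h1 : 1 / 2 ≤ ‖1 - b n * x‖ := by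
    have := norm_sub_norm_le (1 : ℂ) (b n * x)
    rw [norm_one, norm_mul] at this
    linarith
  rw [div_le_iff₀ (by linarith)]
  have := mul_le_mul_of_nonneg_left h1 (by positivity : (0 : ℝ) ≤ 2 * ‖x‖ * ‖b n‖ ^ 2)
  nlinarith [norm_nonneg (b n), norm_nonneg x, this]

/-- The two-point terms are absolutely summable: `‖bₙ‖²/(‖1 − bₙ z‖ ‖1 − bₙ v‖) ≤ 4 ‖bₙ‖²` eventually. -/
theorem summable_twoPoint_terms {b : ℕ → ℂ} (hb : Summable fun n ↦ ‖b n‖ ^ 2) (z v : ℂ) :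
    Summable fun n ↦ ‖b n‖ ^ 2 / (‖1 - b n * z‖ * ‖1 - b n * v‖) := by
  have hz : ∀ᶠ n in atTop, ‖b n‖ * ‖z‖ ≤ 1 / 2 := eventually_norm_mul_le hb ‖z‖ (by norm_num)
  have hv : ∀ᶠ n in atTop, ‖b n‖ * ‖v‖ ≤ 1 / 2 := eventually_norm_mul_le hb ‖v‖ (by norm_num)
  refine Summable.of_norm_bounded_eventually (g := fun n ↦ 4 * ‖b n‖ ^ 2) (hb.mul_left 4) ?_
  rw [Nat.cofinite_eq_atTop]
  filter_upwards [hz, hv] with n hnz hnv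
  have h1 : 1 / 2 ≤ ‖1 - b n * z‖ := by
    have := norm_sub_norm_le (1 : ℂ) (b n * z)
    rw [norm_one, norm_mul] at this
    linarith
  have h2 : 1 / 2 ≤ ‖1 - b n * v‖ := by
    have := norm_sub_norm_le (1 : ℂ) (b n * v)
    rw [norm_one, norm_mul] at this
    linarith
  rw [Real.norm_eq_abs, abs_of_nonneg (by positivity)]
  rw [div_le_iff₀ (by positivity)]
  have h12 : 1 / 4 ≤ ‖1 - b n * z‖ * ‖1 - b n * v‖ := by nlinarith
  nlinarith [sq_nonneg ‖b n‖, h12]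

/-- **Logarithmic derivative of a genus-one Hadamard product.** If `F` is differentiable at `x`,
`F 0 ≠ 0`, `F x ≠ 0`, `Σ ‖bₙ‖² < ∞` and `F z / (F 0 · e^{A z}) = ∏ₙ (1 − bₙ z) e^{bₙ z}` for all `z`,
then `F'(x)/F(x) = A + Σₙ (−bₙ² x)/(1 − bₙ x)` (`= A + Σ' [1/(x − aₙ) + 1/aₙ]`, `aₙ = bₙ⁻¹`).
[cite: Conway1978, Ch. XI Thm. 3.4] [cite: Boas1954, §2.7] -/
theorem logDeriv_eq_const_add_tsum {F : ℂ → ℂ} (h0 : F 0 ≠ 0) {A : ℂ} {b : ℕ → ℂ}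
    (hb : Summable fun n ↦ ‖b n‖ ^ 2)
    (hprod : ∀ z : ℂ, HasProd (fun n ↦ (1 - b n * z) * exp (b n * z)) (F z / (F 0 * exp (A * z))))
    {x : ℂ} (hx : F x ≠ 0) (hF : DifferentiableAt ℂ F x) :
    logDeriv F x = A + ∑' n, -(b n) ^ 2 * x / (1 - b n * x) := by
  set K : Set ℂ := Metric.ball 0 (‖x‖ + 1) with hK
  have hKo : IsOpen K := Metric.isOpen_ball
  have hxK : x ∈ K := by simp [hK]
  set g : ℕ → ℂ → ℂ := fun n z ↦ (1 - b n * z) * exp (b n * z) - 1 with hg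
  have hfac : ∀ n z, 1 + g n z = (1 - b n * z) * exp (b n * z) := by
    intro n z; simp only [hg]; ring
  -- the product in the `1 + g n z` form is `F z / (F 0 * exp (A z))`
  have hprod_fun : (fun z ↦ ∏' n, (1 + g n z)) = fun z ↦ F z / (F 0 * exp (A * z)) := by
    funext z
    have := (hprod z).tprod_eq
    simp only [hfac]
    exact this
  -- tail bound on the disc of radius `ρ = ‖x‖ + 1`
  have hρ : 0 < ‖x‖ + 1 := by positivity
  have hev : ∀ᶠ n in atTop, ‖b n‖ * (‖x‖ + 1) ≤ 1 := eventually_norm_mul_le hb _ one_pos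
  have hmult : MultipliableLocallyUniformlyOn (fun n z ↦ 1 + g n z) K := by
    refine Summable.multipliableLocallyUniformlyOn_nat_one_add hKo
      (u := fun n ↦ ‖b n‖ ^ 2 * ((‖x‖ + 1) ^ 2 * Real.exp 1)) (hb.mul_right _) ?_
      fun n ↦ by fun_prop
    filter_upwards [hev] with n hn z hz
    have hz' : ‖z‖ ≤ ‖x‖ + 1 := by
      simp only [hK, Metric.mem_ball, dist_zero_right] at hz; exact hz.le
    have hw : ‖b n * z‖ ≤ ‖b n‖ * (‖x‖ + 1) := by
      rw [norm_mul]; exact mul_le_mul_of_nonneg_left hz' (norm_nonneg _)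
    have hw1 : ‖b n * z‖ ≤ 1 := hw.trans hn
    calc ‖g n z‖ = ‖(1 - b n * z) * exp (b n * z) - 1‖ := rfl
      _ ≤ ‖b n * z‖ ^ 2 * Real.exp ‖b n * z‖ := HadamardGenusOne.norm_primaryFactor_sub_one_le _
      _ ≤ (‖b n‖ * (‖x‖ + 1)) ^ 2 * Real.exp 1 := by
          gcongr
      _ = ‖b n‖ ^ 2 * ((‖x‖ + 1) ^ 2 * Real.exp 1) := by ring
  -- the log-derivative of one primary factor
  have hlog : ∀ n, logDeriv (fun z ↦ 1 + g n z) x = -(b n) ^ 2 * x / (1 - b n * x) := by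
    intro n
    have hne := one_sub_mul_ne_zero_of_hasProd hprod h0 hx n
    have e1 : (fun z ↦ 1 + g n z) = fun z ↦ (1 - b n * z) * exp (b n * z) := funext (hfac n)
    rw [e1, logDeriv_apply]
    have h1 : HasDerivAt (fun z ↦ 1 - b n * z) (-(b n * 1)) x :=
      ((hasDerivAt_id x).const_mul (b n)).const_sub 1
    have h2 : HasDerivAt (fun z ↦ exp (b n * z)) (exp (b n * x) * (b n * 1)) x :=
      ((hasDerivAt_id x).const_mul (b n)).cexp
    have hd : HasDerivAt (fun z ↦ (1 - b n * z) * exp (b n * z))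
        (-(b n * 1) * exp (b n * x) + (1 - b n * x) * (exp (b n * x) * (b n * 1))) x := h1.mul h2
    rw [hd.deriv]
    have hexp : exp (b n * x) ≠ 0 := exp_ne_zero _
    field_simp
    ring
  have h := logDeriv_tprod_eq_tsum hKo hxK (f := fun n z ↦ 1 + g n z)
    (fun n ↦ by rw [hfac]; exact primaryFactor_ne_zero_of_hasProd hprod h0 hx n)
    (fun n ↦ by fun_prop)
    (by simpa only [hlog] using (summable_norm_logDeriv_terms₂ hb x).of_norm)
    hmult
    (by
      have := congrFun hprod_fun x
      rw [this]
      exact div_ne_zero hx (mul_ne_zero h0 (exp_ne_zero _)))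
  simp only [hlog] at h
  rw [hprod_fun] at h
  -- `logDeriv (F / (F 0 · e^{A ·})) x = logDeriv F x − A`
  have hE : DifferentiableAt ℂ (fun z ↦ F 0 * exp (A * z)) x := by fun_prop
  have hEx : F 0 * exp (A * x) ≠ 0 := mul_ne_zero h0 (exp_ne_zero _)
  have hdiv := logDeriv_div x hx hEx hF hE
  have hlogE : logDeriv (fun z ↦ F 0 * exp (A * z)) x = A := by
    rw [logDeriv_const_mul x (F 0) h0, logDeriv_apply]
    have hd : HasDerivAt (fun z ↦ exp (A * z)) (exp (A * x) * (A * 1)) x :=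
      ((hasDerivAt_id x).const_mul A).cexp
    rw [hd.deriv]
    field_simp
  rw [hdiv, hlogE] at h
  -- h : logDeriv F x - A = ∑' …
  rw [← h]
  ring

/-- **The exact two-point identity (genus one).** Off the zeros,
`F'/F (z) − F'/F (v) = Σₙ bₙ² (v − z)/((1 − bₙ z)(1 − bₙ v))` (`= Σ' (v − z)/((aₙ − z)(aₙ − v))`):
the constant `A` of the exponential factor cancels. -/
theorem logDeriv_sub_logDeriv_eq_tsum {F : ℂ → ℂ} (h0 : F 0 ≠ 0) {A : ℂ} {b : ℕ → ℂ}
    (hb : Summable fun n ↦ ‖b n‖ ^ 2)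
    (hprod : ∀ z : ℂ, HasProd (fun n ↦ (1 - b n * z) * exp (b n * z)) (F z / (F 0 * exp (A * z))))
    {z v : ℂ} (hz : F z ≠ 0) (hv : F v ≠ 0) (hFz : DifferentiableAt ℂ F z)
    (hFv : DifferentiableAt ℂ F v) :
    logDeriv F z - logDeriv F v =
      ∑' n, (b n) ^ 2 * (v - z) / ((1 - b n * z) * (1 - b n * v)) := by
  rw [logDeriv_eq_const_add_tsum h0 hb hprod hz hFz, logDeriv_eq_const_add_tsum h0 hb hprod hv hFv,
    add_sub_add_left_eq_sub,
    ← Summable.tsum_sub (summable_norm_logDeriv_terms₂ hb z).of_norm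
      (summable_norm_logDeriv_terms₂ hb v).of_norm]
  refine tsum_congr fun n ↦ ?_
  have h1 := one_sub_mul_ne_zero_of_hasProd hprod h0 hz n
  have h2 := one_sub_mul_ne_zero_of_hasProd hprod h0 hv n
  field_simp
  ring

/-- **Far-field Lipschitz bound without a Landau constant.** Off the zeros,
`‖F'/F (z) − F'/F (v)‖ ≤ ‖z − v‖ · Σₙ ‖bₙ‖²/(‖1 − bₙ z‖ ‖1 − bₙ v‖)` (`= ‖z − v‖ Σ' 1/(‖aₙ − z‖ ‖aₙ − v‖)`). -/
theorem norm_logDeriv_sub_logDeriv_le {F : ℂ → ℂ} (h0 : F 0 ≠ 0) {A : ℂ} {b : ℕ → ℂ}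
    (hb : Summable fun n ↦ ‖b n‖ ^ 2)
    (hprod : ∀ z : ℂ, HasProd (fun n ↦ (1 - b n * z) * exp (b n * z)) (F z / (F 0 * exp (A * z))))
    {z v : ℂ} (hz : F z ≠ 0) (hv : F v ≠ 0) (hFz : DifferentiableAt ℂ F z)
    (hFv : DifferentiableAt ℂ F v) :
    ‖logDeriv F z - logDeriv F v‖ ≤
      ‖z - v‖ * ∑' n, ‖b n‖ ^ 2 / (‖1 - b n * z‖ * ‖1 - b n * v‖) := by
  rw [logDeriv_sub_logDeriv_eq_tsum h0 hb hprod hz hv hFz hFv]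
  have hterm : ∀ n, ‖(b n) ^ 2 * (v - z) / ((1 - b n * z) * (1 - b n * v))‖ =
      ‖z - v‖ * (‖b n‖ ^ 2 / (‖1 - b n * z‖ * ‖1 - b n * v‖)) := by
    intro n
    rw [norm_div, norm_mul, norm_mul, norm_pow, norm_sub_rev v z]
    ring
  have hs : Summable fun n ↦ ‖(b n) ^ 2 * (v - z) / ((1 - b n * z) * (1 - b n * v))‖ := by
    simp only [hterm]
    exact (summable_twoPoint_terms hb z v).mul_left _
  calc ‖∑' n, (b n) ^ 2 * (v - z) / ((1 - b n * z) * (1 - b n * v))‖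
      ≤ ∑' n, ‖(b n) ^ 2 * (v - z) / ((1 - b n * z) * (1 - b n * v))‖ := norm_tsum_le_tsum_norm hs
    _ = ∑' n, ‖z - v‖ * (‖b n‖ ^ 2 / (‖1 - b n * z‖ * ‖1 - b n * v‖)) := by simp only [hterm]
    _ = ‖z - v‖ * ∑' n, ‖b n‖ ^ 2 / (‖1 - b n * z‖ * ‖1 - b n * v‖) :=
        (summable_twoPoint_terms hb z v).tsum_mul_left _

/-- **Packaged for the engine class**: `F` entire with `‖F z‖ ≤ C e^{‖z‖^ρ}`, `ρ < 2`, `F 0 ≠ 0` ⇒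
Hadamard data `b` from the tree's `hadamard_genus_one_zeros` (the non-zero `bₙ` are the inverse zeros,
each zero `a` hit exactly `analyticOrderNatAt F a` times), the log-derivative series with
`A = F'(0)/F(0)`, and the two-point Lipschitz bound. -/
theorem exists_twoPoint_bound (F : ℂ → ℂ) (ρ C : ℝ) (hF : Differentiable ℂ F) (hρ : ρ < 2)
    (hbound : ∀ z, ‖F z‖ ≤ C * Real.exp (‖z‖ ^ ρ)) (h0 : F 0 ≠ 0) :
    ∃ b : ℕ → ℂ, Summable (fun n ↦ ‖b n‖ ^ 2) ∧
      (∀ n, b n ≠ 0 → F (b n)⁻¹ = 0) ∧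
      (∀ a : ℂ, a ≠ 0 → {n : ℕ | b n = a⁻¹}.ncard = analyticOrderNatAt F a) ∧
      (∀ x : ℂ, F x ≠ 0 →
        logDeriv F x = deriv F 0 / F 0 + ∑' n, -(b n) ^ 2 * x / (1 - b n * x)) ∧
      ∀ z v : ℂ, F z ≠ 0 → F v ≠ 0 →
        ‖logDeriv F z - logDeriv F v‖ ≤
          ‖z - v‖ * ∑' n, ‖b n‖ ^ 2 / (‖1 - b n * z‖ * ‖1 - b n * v‖) := by
  obtain ⟨b, hb, hzero, hmult, hprod⟩ := hadamard_genus_one_zeros F ρ C hF hρ hbound h0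
  exact ⟨b, hb, hzero, hmult,
    fun x hx ↦ logDeriv_eq_const_add_tsum h0 hb hprod hx (hF x),
    fun z v hz hv ↦
      norm_logDeriv_sub_logDeriv_le h0 hb hprod hz hv (hF z) (hF v)⟩

end GenusOneLogDerivC3g41

end Literature.Analysis.Complex
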